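import Mathlib
import HarnessLib
import Summits.NavierStokesRegularity.NavierStokesRegularity.Theorems.PoloidalWindowDoorLrcModEntireFermiTimeWebFunction

/-!
# Route `PoloidalWindowDoor`, item `LrcModEntire` (stmt-NavierStokesRegularity-20428), cell (Q4-sonic, straight, μ < 0) `stub_Q4sonicLineNeg`, case II —
# BRICK B-TWPc, PART T3b-1: THE LOCAL FERMI-FRAME TIME-WEB FUNCTION `G₁` ON A BOX (geometry: smoothness, pin, «Fermi point = line-frame web point», Fermi factor)

Cell ns-regularity-ideate, stub-worker seat ns-poloidal-K2-p2 g18 under the LEAD of item 20428 (ns-poloidal-K2-p3 g17/g18);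
`--supports stmt-NavierStokesRegularity-20428 --as helper`.  Memo `Cruxes/LrcModEntire/TOWER-CLOSES-port2g9.md` §D2/§E (B-TWPc), LEAD 2026-08-29T23:13:57Z; this seat's
design word 23:29Z (LOCAL in σ; no objection: idea-crit-7 g12 23:29:26Z, port-2 g9 23:39:52Z).

Class-free assembly of T1 (`…BaseWebArclength.exists_unitSpeed_graph`) and T2 (`…FermiTimeWebFunction.exists_fermiOffset_local`): for the space–time web function
`n₀` (analytic near the base points `(τ₁, s, 0)`), the base web `γ(s) = s·e + g(s)·Je`, `g = n₀(τ₁,·,0)`, its unit-speed re-parametrisation `Γ = γ ∘ φ` with Frenet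
curvature `k₁`, and a base point `σ₀`:

* `contDiff_baseGraph` — `g` is `C^∞` when `n₀` is analytic at every `(τ₁, s, 0)`;
* ★ `exists_fermi_timeWeb_local` — a box `B = {|τ − τ₁| < ε₁, |σ − σ₀| < ε₁, |z| < ε₁}` (inside the `δ′`-slab of the package: `|τ| < δ′`, `|z| < δ′`) and
  `G₁, S : ℝ³ → ℝ` with: `G₁ ∈ C^∞(B)`; the PIN `G₁(τ₁, σ, 0) = 0`; for every `q = (τ,σ,z) ∈ B` the FERMI POINT IS THE LINE-FRAME WEB POINT,
  `Γσ + G₁(q)·rotJ Γ′σ + z·e₂ = frameCLM e (S q, n₀(τ, S q, z), z)` — so every conjunct of the `δ′`-box package of the curved END applies at it with line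
  parameter `S q` —; and the Fermi factor `1 − k₁(σ)G₁(q) ≠ 0`.  (`G₁ = ψ(τ, φσ, z)·v(φσ)` with the analytic offset `ψ` of T2 and the speed `v = √(1+g′²)`;
  `C^∞` because `ψ` is `C^ω` on a ball BEFORE composing with the `C^∞` inverse arclength `φ`.)

The identities at the Fermi points (criticality, value, ridge law, slice law), the Fermi HUYGENS FAMILY on `B` and the PARALLEL WEBS at `τ₁` are the next file
(T3b-2 `…FermiTimeWebPackage`, class level).  WHAT THIS IS NOT: not a claim about Navier–Stokes regularity; calculus for the research residue
`stub_Q4sonicLineNegIsolated` (bears_on LADDER-NS N0 via item 20428; items 20428 / 19708 / 27893 OPEN).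
-/

noncomputable section

set_option linter.dupNamespace false
set_option linter.style.longLine false

namespace Summit.NavierStokesRegularity.NavierStokesRegularity.Theorems.PoloidalWindowDoorLrcModEntireFermiTimeWebGeometry

open Set Function Filter Topology Metric
open scoped RealInnerProductSpace InnerProductSpace ContDiff
open Summit.NavierStokesRegularity.NavierStokesRegularity.Theorems.PoloidalWindowDoorLrcModEntireSheetFlattenTools
open Summit.NavierStokesRegularity.NavierStokesRegularity.Theorems.PoloidalWindowDoorLrcModEntireRidgeGlobalBranchODE
open Summit.NavierStokesRegularity.NavierStokesRegularity.Theorems.PoloidalWindowDoorLrcModEntireRidgeGlobalBranchFrame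
open Summit.NavierStokesRegularity.NavierStokesRegularity.Theorems.PoloidalWindowDoorLrcModEntireBaseWebArclength
open Summit.NavierStokesRegularity.NavierStokesRegularity.Theorems.PoloidalWindowDoorLrcModEntireFermiTimeWebFunction

/-- **The base graph `g = n₀(τ₁,·,0)` is `C^∞`** when `n₀` is analytic at every `(τ₁, s, 0)`. -/
theorem contDiff_baseGraph {n₀ : ℝ × ℝ × ℝ → ℝ} {τ₁ : ℝ} (hn₀ : ∀ s : ℝ, AnalyticAt ℝ n₀ (τ₁, s, 0)) :
    ContDiff ℝ ∞ (fun s => n₀ (τ₁, s, 0)) := by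
  have han : AnalyticOnNhd ℝ (fun s => n₀ (τ₁, s, 0)) univ := fun s _ =>
    (hn₀ s).comp_of_eq (analyticAt_const.prod (analyticAt_id.prod analyticAt_const)) rfl
  exact han.contDiff.of_le le_top

/-- The sup-metric ball of `ℝ × ℝ × ℝ` around `(τ₁, σ₀, 0)` is the box. -/
theorem mem_ball_iff_box {τ₁ σ₀ ρ : ℝ} {q : ℝ × ℝ × ℝ} :
    q ∈ ball ((τ₁, σ₀, (0 : ℝ)) : ℝ × ℝ × ℝ) ρ ↔ |q.1 - τ₁| < ρ ∧ |q.2.1 - σ₀| < ρ ∧ |q.2.2| < ρ := by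
  rw [mem_ball, Prod.dist_eq, Prod.dist_eq, Real.dist_eq, Real.dist_eq, Real.dist_eq, sub_zero, max_lt_iff, max_lt_iff]

/-- ★ **THE LOCAL FERMI-FRAME TIME-WEB FUNCTION `G₁` ON A BOX.**  See the module docstring.  Hypotheses: `e` horizontal; the unit-speed base web data of T1 BY VALUE
(`Γσ = φσ·e + g(φσ)·Je`, `Γ′σ = (1/v(φσ))·(e + g′(φσ)·Je)`, `φ` `C^∞`, `k₁` continuous); `n₀` analytic at `(τ₁, φσ₀, 0)`; `|τ₁| < δ′`. -/
theorem exists_fermi_timeWeb_local {n₀ : ℝ × ℝ × ℝ → ℝ} {τ₁ σ₀ δ' : ℝ} {e : EuclideanSpace ℝ (Fin 3)} (he2 : e 2 = 0)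
    {Γ : ℝ → EuclideanSpace ℝ (Fin 3)} {φ k₁ : ℝ → ℝ} (hφ : ContDiff ℝ ∞ φ) (hk₁ : Continuous k₁)
    (hΓφ : ∀ σ, Γ σ = φ σ • e + n₀ (τ₁, φ σ, 0) • Jvec e)
    (hΓ' : ∀ σ, deriv Γ σ = (1 / Real.sqrt (1 + deriv (fun s => n₀ (τ₁, s, 0)) (φ σ) ^ 2)) •
      (e + deriv (fun s => n₀ (τ₁, s, 0)) (φ σ) • Jvec e))
    (hg : ContDiff ℝ ∞ (fun s => n₀ (τ₁, s, 0)))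
    (hn₀ : AnalyticAt ℝ n₀ (τ₁, φ σ₀, 0)) (hτ₁ : |τ₁| < δ') :
    ∃ ε₁ : ℝ, 0 < ε₁ ∧ ∃ G₁ S : ℝ × ℝ × ℝ → ℝ,
      ContDiffOn ℝ ∞ G₁ {q : ℝ × ℝ × ℝ | |q.1 - τ₁| < ε₁ ∧ |q.2.1 - σ₀| < ε₁ ∧ |q.2.2| < ε₁} ∧
      (∀ σ : ℝ, |σ - σ₀| < ε₁ → G₁ (τ₁, σ, 0) = 0) ∧
      (∀ q : ℝ × ℝ × ℝ, |q.1 - τ₁| < ε₁ → |q.2.1 - σ₀| < ε₁ → |q.2.2| < ε₁ →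
        Γ q.2.1 + G₁ q • rotJ (deriv Γ q.2.1) + q.2.2 • e2 = frameCLM e (S q, n₀ (q.1, S q, q.2.2), q.2.2) ∧
        1 - k₁ q.2.1 * G₁ q ≠ 0 ∧ |q.1| < δ' ∧ |q.2.2| < δ') := by
  set g : ℝ → ℝ := fun s => n₀ (τ₁, s, 0) with hg_def
  set v : ℝ → ℝ := fun s => Real.sqrt (1 + deriv g s ^ 2) with hv_def
  set s₀ : ℝ := φ σ₀ with hs₀
  set x₀ : ℝ × ℝ × ℝ := (τ₁, s₀, 0) with hx₀
  set q₀ : ℝ × ℝ × ℝ := (τ₁, σ₀, 0) with hq₀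
  -- T2: the analytic offset `ψ` on a ball around `x₀`
  obtain ⟨ε, hε, η, hη, ψ, hψω, hψ0, hψrel, -, hψpin⟩ := exists_fermiOffset_local (τ₁ := τ₁) (s₀ := s₀) hn₀
  -- the change of parameter `Φ(τ,σ,z) = (τ, φσ, z)` and the candidate `G₁ = (ψ ∘ Φ)·(v ∘ φ)`
  set Φ : ℝ × ℝ × ℝ → ℝ × ℝ × ℝ := fun q => (q.1, φ q.2.1, q.2.2) with hΦ
  have hΦcd : ContDiff ℝ ∞ Φ := contDiff_fst.prodMk ((hφ.comp (contDiff_fst.comp contDiff_snd)).prodMk (contDiff_snd.comp contDiff_snd))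
  have hΦc : Continuous Φ := hΦcd.continuous
  have hΦ0 : Φ q₀ = x₀ := by simp [hΦ, hq₀, hx₀, hs₀]
  set G₁ : ℝ × ℝ × ℝ → ℝ := fun q => ψ (Φ q) * v (φ q.2.1) with hG₁
  set S : ℝ × ℝ × ℝ → ℝ := fun q => φ q.2.1 - ψ (Φ q) * deriv g (φ q.2.1) with hS
  -- the open set where everything holds
  have hvcd : ContDiff ℝ ∞ v := contDiff_speed hg
  have hW₁ : IsOpen (Φ ⁻¹' ball x₀ ε) := isOpen_ball.preimage hΦc
  have hq₀W₁ : q₀ ∈ Φ ⁻¹' ball x₀ ε := by show Φ q₀ ∈ ball x₀ ε; rw [hΦ0]; exact mem_ball_self hε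
  have hG₁cont : ContinuousOn G₁ (Φ ⁻¹' ball x₀ ε) := by
    have h1 : ContinuousOn (fun q => ψ (Φ q)) (Φ ⁻¹' ball x₀ ε) := hψω.continuousOn.comp hΦc.continuousOn fun q hq => hq
    exact h1.mul ((hvcd.continuous.comp (hφ.continuous.comp (continuous_fst.comp continuous_snd))).continuousOn)
  have hJc : ContinuousOn (fun q : ℝ × ℝ × ℝ => k₁ q.2.1 * G₁ q) (Φ ⁻¹' ball x₀ ε) :=
    ((hk₁.comp (continuous_fst.comp continuous_snd)).continuousOn).mul hG₁cont
  have hJ0 : k₁ q₀.2.1 * G₁ q₀ = 0 := by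
    simp only [hG₁, hΦ0]
    rw [show ψ x₀ = 0 from hψ0]; ring
  -- a neighbourhood of `q₀` inside `Φ⁻¹(ball)` on which `|k₁ G₁| < 1/2`
  have hnhds : {q : ℝ × ℝ × ℝ | |k₁ q.2.1 * G₁ q| < 1 / 2} ∩ Φ ⁻¹' ball x₀ ε ∈ 𝓝 q₀ := by
    have hca : ContinuousAt (fun q : ℝ × ℝ × ℝ => k₁ q.2.1 * G₁ q) q₀ := hJc.continuousAt (hW₁.mem_nhds hq₀W₁)
    have h1 : {q : ℝ × ℝ × ℝ | |k₁ q.2.1 * G₁ q| < 1 / 2} ∈ 𝓝 q₀ := by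
      have hlt : |k₁ q₀.2.1 * G₁ q₀| < 1 / 2 := by rw [hJ0, abs_zero]; norm_num
      exact (continuous_abs.continuousAt.comp hca).preimage_mem_nhds (isOpen_Iio.mem_nhds hlt)
    exact Filter.inter_mem h1 (hW₁.mem_nhds hq₀W₁)
  obtain ⟨ρ₀, hρ₀, hball⟩ := Metric.mem_nhds_iff.1 hnhds
  -- the box radius
  set ε₁ : ℝ := min ρ₀ (min (δ' - |τ₁|) δ') with hε₁
  have hδ'pos : 0 < δ' := lt_of_le_of_lt (abs_nonneg _) hτ₁
  have hε₁pos : 0 < ε₁ := lt_min hρ₀ (lt_min (by linarith) hδ'pos)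
  have hε₁ρ : ε₁ ≤ ρ₀ := min_le_left _ _
  have hε₁τ : ε₁ ≤ δ' - |τ₁| := (min_le_right _ _).trans (min_le_left _ _)
  have hε₁δ : ε₁ ≤ δ' := (min_le_right _ _).trans (min_le_right _ _)
  have hbox : ∀ q : ℝ × ℝ × ℝ, |q.1 - τ₁| < ε₁ → |q.2.1 - σ₀| < ε₁ → |q.2.2| < ε₁ →
      |k₁ q.2.1 * G₁ q| < 1 / 2 ∧ Φ q ∈ ball x₀ ε := by
    intro q h1 h2 h3
    have hq : q ∈ ball q₀ ρ₀ := mem_ball_iff_box.2 ⟨lt_of_lt_of_le h1 hε₁ρ, lt_of_lt_of_le h2 hε₁ρ, lt_of_lt_of_le h3 hε₁ρ⟩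
    exact hball hq
  refine ⟨ε₁, hε₁pos, G₁, S, ?_, ?_, ?_⟩
  · -- smoothness on the box (inside `Φ⁻¹(ball)`)
    have hsub : {q : ℝ × ℝ × ℝ | |q.1 - τ₁| < ε₁ ∧ |q.2.1 - σ₀| < ε₁ ∧ |q.2.2| < ε₁} ⊆ Φ ⁻¹' ball x₀ ε :=
      fun q hq => (hbox q hq.1 hq.2.1 hq.2.2).2
    have hψΦ : ContDiffOn ℝ ∞ (fun q => ψ (Φ q)) (Φ ⁻¹' ball x₀ ε) :=
      (hψω.of_le le_top).comp hΦcd.contDiffOn fun q hq => hq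
    have hvφ : ContDiff ℝ ∞ (fun q : ℝ × ℝ × ℝ => v (φ q.2.1)) := hvcd.comp (hφ.comp (contDiff_fst.comp contDiff_snd))
    exact (hψΦ.mul hvφ.contDiffOn).mono hsub
  · -- the pin at the base time
    intro σ hσ
    have hmem := (hbox (τ₁, σ, 0) (by simp [hε₁pos]) (by simpa using hσ) (by simpa using hε₁pos)).2
    have hpin := hψpin (φ σ) (by rw [hx₀] at hmem; simpa [hΦ] using hmem)
    simp only [hG₁, hΦ]
    rw [hpin, zero_mul]
  · intro q h1 h2 h3
    obtain ⟨hJq, hmem⟩ := hbox q h1 h2 h3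
    refine ⟨?_, ?_, ?_, lt_of_lt_of_le h3 hε₁δ⟩
    · -- Fermi point = line-frame web point
      have hrel := (hψrel (Φ q) hmem).2
      simp only [hΦ] at hrel
      have hv0 : v (φ q.2.1) ≠ 0 := (speed_pos (g := g) (φ q.2.1)).ne'
      rw [hΓφ q.2.1, hΓ' q.2.1]
      have hstep1 := fermiPoint_eq_unitNormal he2 (φ q.2.1 • e + n₀ (τ₁, φ q.2.1, 0) • Jvec e) hv0 (deriv g (φ q.2.1)) (ψ (Φ q))
      simp only [hG₁]
      rw [hstep1, fermiPoint_eq_webPoint e (φ q.2.1) (n₀ (τ₁, φ q.2.1, 0)) (deriv g (φ q.2.1)) (ψ (Φ q)) q.2.2]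
      simp only [hS, hΦ]
      rw [hrel]
    · intro hJ
      have : |k₁ q.2.1 * G₁ q| = 1 := by rw [show k₁ q.2.1 * G₁ q = 1 by linarith]; simp
      linarith
    · have := abs_sub_abs_le_abs_sub q.1 τ₁
      linarith [hε₁τ]

end Summit.NavierStokesRegularity.NavierStokesRegularity.Theorems.PoloidalWindowDoorLrcModEntireFermiTimeWebGeometry

end
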